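import Summits.PneNP.PneNP.Theorems.NegLimitedCliqueSlices
import Summits.PneNP.PneNP.Theorems.NegLimitedCliqueLikeNegLimitedLogQuasi

/-!
# Route NegLimited — almost-everywhere form of R35-CLIQUE: every length, not only squares (rung F-N1/p3)

`NegLimitedCliqueSlices.lean` gives the bound at square lengths `n = m²` (`∃ᶠ n`). Padding removes
the restriction: `padCliqueLang = {u | u ↾ ⌊√|u|⌋² ∈ sqrtCliqueLang}` is in `NP`, its slice at ANY
length `n` is the `⌊√m⌋`-clique slice of the first `m²` coordinates (`m = ⌊√n⌋`), and
* `neglimitedLogNegations_clique_ae`: for every `k`, for ALL large `n`, the slice is monotone and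
  needs `> n^k` De Morgan gates under `⌊log₂ m⌋ / (20 (⌊log₂⌊log₂ m⌋⌋ + 1))` NOT gates, `m = ⌊√n⌋`
  (`= (1 + o(1)) · log₂ n / (40 log₂ log₂ n)`); `…_quasi`: size `≥ 2^{⌊log₂ m⌋²}` (engine T1q);
* `neglimitedLogOverLoglogNegations_ae`: the same with the closed-form budget
  `⌊log₂ n⌋ / (100 (⌊log₂⌊log₂ n⌋⌋ + 1))` — the `∀ᶠ` (almost-everywhere) strengthening of R35;
* `neglimitedAllCLoglogNegations_ae`: ONE language, every `c`, all large `n`, `c ⌊log₂⌊log₂ n⌋⌋`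
  NOT gates — the `∀ᶠ` strengthening of crux #3 (stmt-PneNP-0412) / R3R;
* `negations_needed_ae` (headline form): for all large `n`, every De Morgan circuit of size `≤ n^k`
  for the slice has `> ⌊log₂ n⌋ / (100 (⌊log₂⌊log₂ n⌋⌋ + 1))` NOT gates.
Cell record: HOME/pnp-ideate-p3/ROUND-3.md §(7).
-/

set_option linter.dupNamespace false -- `Summit.PneNP.PneNP.…`: summit = sub-problem name (D-0017 single-conjunct layout)

namespace Summit.PneNP.PneNP.Theorems.NegLimSlices

open Literature.Computability.Complexity Literature.Computability.Complexity.Brick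
  Literature.Barriers.PneNP _root_.Computability Polynomial Filter Finset

/-! ## The padded language -/

/-- The side `1^{⌊√|u|⌋}` of a string. [folklore] -/
noncomputable def sideFn : List Bool → List Bool :=
  binToUnaryFn ∘ fanoutFn (fun u => u) isqrtFn

/-- The square prefix `u ↾ ⌊√|u|⌋²`. [folklore] -/
noncomputable def sqPrefixFn : List Bool → List Bool :=
  Plumb.takeFn ∘ fanoutFn (UnaryOffsets.mulLenFn ∘ fanoutFn sideFn sideFn) fun u => u

/-- `sideFn u = 1^{⌊√|u|⌋}`. [folklore] -/
theorem sideFn_apply (u : List Bool) : sideFn u = ones (Nat.sqrt u.length) := by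
  simp only [sideFn, Function.comp_apply, fanoutFn_apply, isqrtFn_apply, binToUnaryFn_boolPair,
    bitsToNat_encodeNat, min_eq_left (Nat.sqrt_le_self _)]

/-- `sqPrefixFn u = u ↾ ⌊√|u|⌋²`. [folklore] -/
theorem sqPrefixFn_apply (u : List Bool) :
    sqPrefixFn u = u.take (Nat.sqrt u.length * Nat.sqrt u.length) := by
  simp only [sqPrefixFn, Function.comp_apply, fanoutFn_apply, Plumb.takeFn_boolPair,
    UnaryOffsets.length_mulLenFn, sideFn_apply, ones, List.length_replicate]

/-- `sqPrefixFn ∈ FP`. [cite: AroraBarakCC2009, §1.3] -/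
theorem sqPrefixFn_mem_FP : sqPrefixFn ∈ FP := by
  have hid : (fun u : List Bool => u) ∈ FP := PolyTimeComputable.id _
  have hside : sideFn ∈ FP := comp_mem_FP binToUnaryFn_mem_FP (fanoutFn_mem_FP hid isqrtFn_mem_FP)
  exact comp_mem_FP Plumb.takeFn_mem_FP (fanoutFn_mem_FP
    (comp_mem_FP UnaryOffsets.mulLenFn_mem_FP (fanoutFn_mem_FP hside hside)) hid)

/-- **The padded `⌊√m⌋`-clique language**: `u` whose square prefix is in `sqrtCliqueLang`.
[cite: AroraBarak2009, §2.1 Ex. 2.2] -/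
def padCliqueLang : Language Bool := {u | sqPrefixFn u ∈ sqrtCliqueLang}

/-- The verifier language of the padded language. [folklore] -/
def padVerLang : Language Bool :=
  {z | CliqueVerifier.verFn (fanoutFn (sqPrefixFn ∘ fstF) sndF z) = [true]}

/-- The padded verifier language is in `P`. [cite: AroraBarakCC2009, Thm. 2.8] -/
theorem padVerLang_mem_P : padVerLang ∈ Classes.P :=
  setOf_apply_eq_apply_mem_P (comp_mem_FP CliqueVerifier.verFn_mem_FP
    (fanoutFn_mem_FP (comp_mem_FP sqPrefixFn_mem_FP fstF_mem_FP) sndF_mem_FP)) (const_mem_FP [true])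

/-- The certificate may be truncated to the side length. [folklore] -/
theorem accepts_take {u y : List Bool} {m : ℕ} :
    CliqueVerifier.accepts u (y.take m) m = CliqueVerifier.accepts u y m := by
  simp only [CliqueVerifier.accepts, List.take_take, min_self]

/-- Membership in the padded language. [folklore] -/
theorem mem_padCliqueLang {u : List Bool} : u ∈ padCliqueLang ↔ sqPrefixFn u ∈ sqrtCliqueLang :=
  Iff.rfl

/-- Membership in `sqrtCliqueLang`, unfolded. [folklore] -/
theorem mem_sqrtCliqueLang {u : List Bool} : u ∈ sqrtCliqueLang ↔
    ∃ y : List Bool, y.length ≤ u.length ∧ CliqueVerifier.verFn (boolPair u y) = [true] := by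
  have h : u ∈ sqrtCliqueLang ↔ ∃ y : List Bool, y.length ≤ (X : Polynomial ℕ).eval u.length ∧
      boolPair u y ∈ cliqueVerLang := Iff.rfl
  rw [h]
  simp only [eval_X, mem_cliqueVerLang]

/-- Membership in the padded verifier language. [folklore] -/
theorem mem_padVerLang {u y : List Bool} : boolPair u y ∈ padVerLang ↔
    CliqueVerifier.verFn (boolPair (sqPrefixFn u) y) = [true] := by
  have h : boolPair u y ∈ padVerLang ↔
      CliqueVerifier.verFn (fanoutFn (sqPrefixFn ∘ fstF) sndF (boolPair u y)) = [true] := Iff.rfl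
  rw [h, fanoutFn_apply]
  simp only [Function.comp_apply, fstF_boolPair, sndF_boolPair]

/-- **`padCliqueLang ∈ NP`.** [cite: AroraBarak2009, Def. 2.1] -/
theorem padCliqueLang_mem_NP : padCliqueLang ∈ Nondeterministic.NP := by
  refine mem_NP_iff_verifier.2 ⟨padVerLang, padVerLang_mem_P, X, fun u => ?_⟩
  have hmm : Nat.sqrt u.length * Nat.sqrt u.length ≤ u.length := Nat.sqrt_le u.length
  have hlen : (sqPrefixFn u).length = Nat.sqrt u.length * Nat.sqrt u.length := by
    rw [sqPrefixFn_apply, List.length_take, min_eq_left hmm]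
  rw [mem_padCliqueLang, mem_sqrtCliqueLang]
  simp only [eval_X, mem_padVerLang, CliqueVerifier.verFn_sq hlen, List.cons.injEq, and_true]
  constructor
  · rintro ⟨y, hy, hacc⟩
    exact ⟨y, hy.trans (hlen.le.trans hmm), hacc⟩
  · rintro ⟨y, -, hacc⟩
    refine ⟨y.take (Nat.sqrt u.length), ?_, by rwa [accepts_take]⟩
    rw [List.length_take, hlen]
    exact (min_le_left _ _).trans (Nat.le_mul_self _)

/-! ## Slices at every length -/

/-- Truncating `List.ofFn`. [folklore] -/
theorem take_ofFn {n k : ℕ} (w : Fin n → Bool) (hk : k ≤ n) :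
    (List.ofFn w).take k = List.ofFn fun i : Fin k => w (Fin.castLE hk i) := by
  apply List.ext_getElem
  · simp [min_eq_left hk]
  · intro i h1 h2
    simp [List.getElem_take, List.getElem_ofFn]

variable {n : ℕ}

/-- **The slice of the padded language at length `n` is the clique slice of the first `m²`
coordinates**, `m = ⌊√n⌋`. [folklore] -/
theorem sliceFn_padCliqueLang (w : Fin n → Bool) :
    padCliqueLang.sliceFn n w = sqrtCliqueLang.sliceFn (Nat.sqrt n * Nat.sqrt n)
      (fun i => w (Fin.castLE (Nat.sqrt_le n) i)) := by
  have h : List.ofFn w ∈ padCliqueLang ↔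
      (List.ofFn fun i => w (Fin.castLE (Nat.sqrt_le n) i)) ∈ sqrtCliqueLang := by
    rw [mem_padCliqueLang, sqPrefixFn_apply, List.length_ofFn, take_ofFn w (Nat.sqrt_le n)]
  show padCliqueLang.boolIndicator (List.ofFn w) = sqrtCliqueLang.boolIndicator (List.ofFn _)
  rw [Bool.eq_iff_iff]
  exact (Set.mem_iff_boolIndicator _ _).symm.trans (h.trans (Set.mem_iff_boolIndicator _ _))

/-- The slices of the padded language are monotone (`1 ≤ n`). [folklore] -/
theorem monotone_sliceFn_padCliqueLang (hn : 1 ≤ n) : Monotone (padCliqueLang.sliceFn n) := by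
  intro x y hxy
  rw [sliceFn_padCliqueLang, sliceFn_padCliqueLang]
  exact monotone_sliceFn_sqrtCliqueLang (Nat.le_sqrt.2 (by simpa using hn)) fun i => hxy _

/-- **The transfer package at every length.** For `⌊√n⌋ = m ≥ 4` and any NOT budget `b`: a lower
bound `s` for every De Morgan circuit with `≤ b` NOT gates computing `CLIQUE(m, ⌊√m⌋)` gives
`s ≤ negLimitedSizeOver deMorganBasis b (L_n)`. [folklore] -/
theorem le_negLimitedSizeOver_sliceFn_pad (hm : 4 ≤ Nat.sqrt n) {b s : ℕ}
    (hlow : ∀ D : Circuit (KEdge (Nat.sqrt n)), D.IsOver deMorganBasis →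
      D.Computes (cliqueFn (Nat.sqrt n) (Nat.sqrt (Nat.sqrt n))) → D.negationCount ≤ b → s ≤ D.size) :
    s ≤ negLimitedSizeOver deMorganBasis b (padCliqueLang.sliceFn n) := by
  have hmm : Nat.sqrt n * Nat.sqrt n ≤ n := Nat.sqrt_le n
  have hk : 2 ≤ Nat.sqrt (Nat.sqrt n) := Nat.le_sqrt'.2 (by omega)
  have hTcl : CliqueLike (univ : Finset (Fin (Nat.sqrt n))) (Nat.sqrt (Nat.sqrt n) - 1)
      (Nat.sqrt (Nat.sqrt n)) (cliqueFn (Nat.sqrt n) (Nat.sqrt (Nat.sqrt n))) :=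
    cliqueLike_cliqueFn (m := Nat.sqrt n) (Nat.le_sqrt.2 (by omega))
  have e₀ : KEdge (Nat.sqrt n) := ⟨s(⟨0, by omega⟩, ⟨1, by omega⟩), by simp [Fin.ext_iff]⟩
  -- the retraction `Fin n → KEdge m`: the first `m²` coordinates to edges, the rest to `e₀`
  let r : Fin n → KEdge (Nat.sqrt n) := fun i =>
    if h : (i : ℕ) < Nat.sqrt n * Nat.sqrt n then edgeOfPos e₀ ⟨i, h⟩ else e₀
  refine le_negLimitedSizeOver_of_retract (g := cliqueFn (Nat.sqrt n) (Nat.sqrt (Nat.sqrt n))) r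
    (fun y => ?_) ?_ hlow
  · rw [sliceFn_padCliqueLang, sliceFn_sqrtCliqueLang (by omega)]
    congr 1
    funext e
    have he : ((Fin.castLE hmm (edgePos e) : Fin n) : ℕ) < Nat.sqrt n * Nat.sqrt n := (edgePos e).2
    show y (r (Fin.castLE hmm (edgePos e))) = y e
    simp only [r, dif_pos he]
    exact congrArg y (edgeOfPos_edgePos e₀ e)
  · obtain ⟨C₀, hB₀, hC₀⟩ :=
      exists_monotone_circuit_of_cliqueLike hTcl (by omega) (Nat.sqrt_le_self _)
    refine ⟨C₀.mapInputs fun e => Fin.castLE hmm (edgePos e),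
      (hB₀.mapInputs _).mono monotoneBasis_subset_deMorgan, ?_, fun x => ?_⟩
    · rw [negationCount_mapInputs, Circuit.negationCount_eq_zero_of_isOver_monotoneBasis hB₀]
      exact Nat.zero_le _
    · rw [Circuit.eval_mapInputs, hC₀, sliceFn_padCliqueLang, sliceFn_sqrtCliqueLang (by omega)]
      rfl

/-- `n^k < m^{4k+1}` for `m = ⌊√n⌋ ≥ 4`: `n < (m+1)² ≤ 4m²`, so `n^k ≤ 4^k m^{2k} ≤ m^{4k}`. [folklore] -/
theorem pow_lt_sqrt_pow {n : ℕ} (h4 : 4 ≤ Nat.sqrt n) (k : ℕ) : n ^ k < Nat.sqrt n ^ (4 * k + 1) := by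
  have hn : n < 4 * (Nat.sqrt n * Nat.sqrt n) := by nlinarith [Nat.lt_succ_sqrt n]
  have h16 : 4 ≤ Nat.sqrt n * Nat.sqrt n := by nlinarith
  calc n ^ k ≤ (4 * (Nat.sqrt n * Nat.sqrt n)) ^ k := Nat.pow_le_pow_left hn.le k
    _ ≤ (Nat.sqrt n * Nat.sqrt n * (Nat.sqrt n * Nat.sqrt n)) ^ k :=
        Nat.pow_le_pow_left (Nat.mul_le_mul_right _ h16) k
    _ = Nat.sqrt n ^ (4 * k) := by
        rw [show Nat.sqrt n * Nat.sqrt n * (Nat.sqrt n * Nat.sqrt n) = Nat.sqrt n ^ 4 by ring, ← pow_mul]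
    _ < Nat.sqrt n ^ (4 * k + 1) := Nat.pow_lt_pow_right (by omega) (by omega)

/-- **R35-CLIQUE almost everywhere** (engine budget): for every `k`, for all large `n`, the slice
of `padCliqueLang` is monotone and needs `> n^k` De Morgan gates under
`⌊log₂ m⌋ / (20 (⌊log₂⌊log₂ m⌋⌋ + 1))` NOT gates, `m = ⌊√n⌋`. -/
theorem neglimitedLogNegations_clique_ae :
    padCliqueLang ∈ Literature.Computability.Complexity.Nondeterministic.NP ∧ ∀ k : ℕ,
      ∀ᶠ n : ℕ in Filter.atTop, Monotone (padCliqueLang.sliceFn n) ∧ n ^ k <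
        Literature.Computability.Complexity.negLimitedSizeOver
          Literature.Computability.Complexity.deMorganBasis
          (Nat.log 2 (Nat.sqrt n) / (20 * (Nat.log 2 (Nat.log 2 (Nat.sqrt n)) + 1)))
          (padCliqueLang.sliceFn n) := by
  refine ⟨padCliqueLang_mem_NP, fun k => ?_⟩
  -- `⌊√n⌋ → ∞` [folklore], stated locally
  have tendsto_sqrt_atTop : Tendsto Nat.sqrt atTop atTop :=
    tendsto_atTop_atTop.2 fun b => ⟨b * b, fun n hn => by
      rw [← Nat.sqrt_eq b]; exact Nat.sqrt_le_sqrt hn⟩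
  filter_upwards [tendsto_sqrt_atTop.eventually (NegLimLog.cliqueLikeNegLimitedLog (4 * k + 1)),
    tendsto_sqrt_atTop.eventually (eventually_ge_atTop 4)] with n hT h4
  have hle : Nat.sqrt n ^ (4 * k + 1) ≤ negLimitedSizeOver deMorganBasis
      (Nat.log 2 (Nat.sqrt n) / (20 * (Nat.log 2 (Nat.log 2 (Nat.sqrt n)) + 1)))
      (padCliqueLang.sliceFn n) :=
    le_negLimitedSizeOver_sliceFn_pad h4 fun D hD hDT hneg =>
      hT _ (cliqueLike_cliqueFn (m := Nat.sqrt n) (Nat.le_sqrt.2 (by omega))) D hD hDT hneg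
  exact ⟨monotone_sliceFn_padCliqueLang (by nlinarith [Nat.sqrt_le n]),
    lt_of_lt_of_le (pow_lt_sqrt_pow h4 k) hle⟩

/-- **Quasi-polynomial form, almost everywhere** (engine T1q): for all large `n`, the slice of
`padCliqueLang` is monotone and needs `≥ 2^{⌊log₂ m⌋²} = m^{⌊log₂ m⌋}` De Morgan gates under
`⌊log₂ m⌋ / (20 (⌊log₂⌊log₂ m⌋⌋ + 1))` NOT gates, `m = ⌊√n⌋` (so `≥ n^{(1/4 − o(1)) log₂ n}`). -/
theorem neglimitedLogNegations_clique_ae_quasi :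
    ∀ᶠ n : ℕ in Filter.atTop, Monotone (padCliqueLang.sliceFn n) ∧
      2 ^ Nat.log 2 (Nat.sqrt n) ^ 2 ≤
        Literature.Computability.Complexity.negLimitedSizeOver
          Literature.Computability.Complexity.deMorganBasis
          (Nat.log 2 (Nat.sqrt n) / (20 * (Nat.log 2 (Nat.log 2 (Nat.sqrt n)) + 1)))
          (padCliqueLang.sliceFn n) := by
  -- `⌊√n⌋ → ∞` [folklore], stated locally
  have tendsto_sqrt_atTop : Tendsto Nat.sqrt atTop atTop :=
    tendsto_atTop_atTop.2 fun b => ⟨b * b, fun n hn => by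
      rw [← Nat.sqrt_eq b]; exact Nat.sqrt_le_sqrt hn⟩
  filter_upwards [tendsto_sqrt_atTop.eventually NegLimLog.cliqueLikeNegLimitedLogQuasi,
    tendsto_sqrt_atTop.eventually (eventually_ge_atTop 4)] with n hT h4
  exact ⟨monotone_sliceFn_padCliqueLang (by nlinarith [Nat.sqrt_le n]),
    le_negLimitedSizeOver_sliceFn_pad h4 fun D hD hDT hneg =>
      hT _ (cliqueLike_cliqueFn (m := Nat.sqrt n) (Nat.le_sqrt.2 (by omega))) D hD hDT hneg⟩

/-- Budget comparison: `⌊log₂ n⌋ / (100 (⌊log₂⌊log₂ n⌋⌋ + 1)) ≤ ⌊log₂ m⌋ / (20 (⌊log₂⌊log₂ m⌋⌋ + 1))`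
for `m = ⌊√n⌋ ≥ 2` (`⌊log₂ n⌋ ≤ 2⌊log₂ m⌋ + 3 ≤ 5⌊log₂ m⌋`). [folklore] -/
theorem budget100_le_logBudget_sqrt (hm : 2 ≤ Nat.sqrt n) :
    Nat.log 2 n / (100 * (Nat.log 2 (Nat.log 2 n) + 1)) ≤
      Nat.log 2 (Nat.sqrt n) / (20 * (Nat.log 2 (Nat.log 2 (Nat.sqrt n)) + 1)) := by
  have hmm : Nat.sqrt n * Nat.sqrt n ≤ n := Nat.sqrt_le n
  have hn : n < (Nat.sqrt n + 1) * (Nat.sqrt n + 1) := Nat.lt_succ_sqrt n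
  have hL1 : 1 ≤ Nat.log 2 (Nat.sqrt n) := Nat.le_log_of_pow_le (by norm_num) (by simpa using hm)
  -- `⌊log₂ n⌋ ≤ 2 ⌊log₂ (m+1)⌋ + 1 ≤ 2 ⌊log₂ m⌋ + 3 ≤ 5 ⌊log₂ m⌋`
  have hlogn : Nat.log 2 n ≤ 5 * Nat.log 2 (Nat.sqrt n) := by
    have h1 : Nat.log 2 n ≤ Nat.log 2 ((Nat.sqrt n + 1) * (Nat.sqrt n + 1)) :=
      Nat.log_mono_right hn.le
    have h2 : Nat.log 2 ((Nat.sqrt n + 1) * (Nat.sqrt n + 1)) ≤ 2 * Nat.log 2 (Nat.sqrt n + 1) + 1 :=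
      log_sq_le (Nat.sqrt n + 1)
    have h3 : Nat.log 2 (Nat.sqrt n + 1) ≤ Nat.log 2 (Nat.sqrt n) + 1 := by
      have h : Nat.log 2 (Nat.sqrt n + 1) ≤ Nat.log 2 (Nat.sqrt n * 2) := Nat.log_mono_right (by omega)
      rwa [Nat.log_mul_base (by norm_num) (by omega)] at h
    omega
  have hK : Nat.log 2 (Nat.log 2 (Nat.sqrt n)) ≤ Nat.log 2 (Nat.log 2 n) :=
    Nat.log_mono_right (Nat.log_mono_right ((Nat.le_mul_self _).trans hmm))
  calc Nat.log 2 n / (100 * (Nat.log 2 (Nat.log 2 n) + 1))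
      ≤ 5 * Nat.log 2 (Nat.sqrt n) / (100 * (Nat.log 2 (Nat.log 2 (Nat.sqrt n)) + 1)) :=
        Nat.div_le_div hlogn (Nat.mul_le_mul_left _ (by omega)) (by omega)
    _ = Nat.log 2 (Nat.sqrt n) / (20 * (Nat.log 2 (Nat.log 2 (Nat.sqrt n)) + 1)) := by
        rw [show 100 * (Nat.log 2 (Nat.log 2 (Nat.sqrt n)) + 1) =
            5 * (20 * (Nat.log 2 (Nat.log 2 (Nat.sqrt n)) + 1)) by ring,
          Nat.mul_div_mul_left _ _ (by norm_num)]

/-- **R35 almost everywhere** (closed-form budget): an `NP` language (the padded `⌊√m⌋`-clique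
language) with, for every `k` and ALL large `n`, a monotone slice of negation-limited complexity
`> n^k` under `⌊log₂ n⌋ / (100 (⌊log₂⌊log₂ n⌋⌋ + 1))` NOT gates. -/
theorem neglimitedLogOverLoglogNegations_ae :
    ∃ L ∈ Literature.Computability.Complexity.Nondeterministic.NP, ∀ k : ℕ,
      ∀ᶠ n : ℕ in Filter.atTop, Monotone (L.sliceFn n) ∧ n ^ k <
        Literature.Computability.Complexity.negLimitedSizeOver
          Literature.Computability.Complexity.deMorganBasis
          (Nat.log 2 n / (100 * (Nat.log 2 (Nat.log 2 n) + 1))) (L.sliceFn n) := by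
  refine ⟨padCliqueLang, padCliqueLang_mem_NP, fun k => ?_⟩
  -- `⌊√n⌋ → ∞` [folklore], stated locally
  have tendsto_sqrt_atTop : Tendsto Nat.sqrt atTop atTop :=
    tendsto_atTop_atTop.2 fun b => ⟨b * b, fun n hn => by
      rw [← Nat.sqrt_eq b]; exact Nat.sqrt_le_sqrt hn⟩
  filter_upwards [tendsto_sqrt_atTop.eventually (NegLimLog.cliqueLikeNegLimitedLog (4 * k + 1)),
    tendsto_sqrt_atTop.eventually (eventually_ge_atTop 4)] with n hT h4
  have hle : Nat.sqrt n ^ (4 * k + 1) ≤ negLimitedSizeOver deMorganBasis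
      (Nat.log 2 n / (100 * (Nat.log 2 (Nat.log 2 n) + 1))) (padCliqueLang.sliceFn n) :=
    le_negLimitedSizeOver_sliceFn_pad h4 fun D hD hDT hneg =>
      hT _ (cliqueLike_cliqueFn (m := Nat.sqrt n) (Nat.le_sqrt.2 (by omega))) D hD hDT
        (hneg.trans (budget100_le_logBudget_sqrt (by omega)))
  exact ⟨monotone_sliceFn_padCliqueLang (by nlinarith [Nat.sqrt_le n]),
    lt_of_lt_of_le (pow_lt_sqrt_pow h4 k) hle⟩

/-- Budget comparison for the `c · log log` family: `c ⌊log₂⌊log₂ n⌋⌋ ≤ ⌊log₂ m⌋ / (20 (⌊log₂⌊log₂ m⌋⌋ + 1))`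
for `m = ⌊√n⌋` once `K = ⌊log₂⌊log₂ m⌋⌋ ≥ max 64 (c + 2)` (via `c (K+2) ≤ K² ≤ sqrtLogBudget m`). [folklore] -/
theorem cloglog_le_logBudget_sqrt {c : ℕ} (hK : 64 ≤ Nat.log 2 (Nat.log 2 (Nat.sqrt n)))
    (hc : c + 2 ≤ Nat.log 2 (Nat.log 2 (Nat.sqrt n))) :
    c * Nat.log 2 (Nat.log 2 n) ≤
      Nat.log 2 (Nat.sqrt n) / (20 * (Nat.log 2 (Nat.log 2 (Nat.sqrt n)) + 1)) := by
  have hn : n < (Nat.sqrt n + 1) * (Nat.sqrt n + 1) := Nat.lt_succ_sqrt n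
  have hL0 : Nat.log 2 (Nat.sqrt n) ≠ 0 := fun h => by rw [h, Nat.log_zero_right] at hK; omega
  have hL2 : 2 ≤ Nat.log 2 (Nat.sqrt n) := by
    by_contra h
    have h1 : Nat.log 2 (Nat.sqrt n) ≤ 1 := by omega
    have := Nat.log_mono_right (b := 2) h1
    rw [Nat.log_one_right] at this
    omega
  have hm1 : 1 ≤ Nat.sqrt n := by
    by_contra h
    have h0 : Nat.sqrt n = 0 := by omega
    rw [h0, Nat.log_zero_right, Nat.log_zero_right] at hK
    omega
  -- `⌊log₂ n⌋ ≤ 2 ⌊log₂ (m+1)⌋ + 1 ≤ 2 ⌊log₂ m⌋ + 3 ≤ 4 ⌊log₂ m⌋`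
  have hlogn : Nat.log 2 n ≤ Nat.log 2 (Nat.sqrt n) * 2 * 2 := by
    have h1 : Nat.log 2 n ≤ Nat.log 2 ((Nat.sqrt n + 1) * (Nat.sqrt n + 1)) :=
      Nat.log_mono_right hn.le
    have h2 : Nat.log 2 ((Nat.sqrt n + 1) * (Nat.sqrt n + 1)) ≤ 2 * Nat.log 2 (Nat.sqrt n + 1) + 1 :=
      log_sq_le (Nat.sqrt n + 1)
    have h3 : Nat.log 2 (Nat.sqrt n + 1) ≤ Nat.log 2 (Nat.sqrt n) + 1 := by
      have h : Nat.log 2 (Nat.sqrt n + 1) ≤ Nat.log 2 (Nat.sqrt n * 2) := Nat.log_mono_right (by omega)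
      rwa [Nat.log_mul_base (by norm_num) (by omega)] at h
    omega
  have hKn : Nat.log 2 (Nat.log 2 n) ≤ Nat.log 2 (Nat.log 2 (Nat.sqrt n)) + 2 :=
    calc Nat.log 2 (Nat.log 2 n) ≤ Nat.log 2 (Nat.log 2 (Nat.sqrt n) * 2 * 2) :=
          Nat.log_mono_right hlogn
      _ = Nat.log 2 (Nat.log 2 (Nat.sqrt n)) + 2 := by
          rw [Nat.log_mul_base (by norm_num) (by positivity), Nat.log_mul_base (by norm_num) hL0]
  have hsq : sqrtLogBudget (Nat.sqrt n) ≤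
      Nat.log 2 (Nat.sqrt n) / (20 * (Nat.log 2 (Nat.log 2 (Nat.sqrt n)) + 1)) := by
    unfold sqrtLogBudget
    refine Nat.div_le_div ?_ (by omega) (by omega)
    exact (Nat.pow_le_pow_right (by norm_num) (Nat.div_le_self _ 2)).trans
      (Nat.pow_log_le_self 2 hL0)
  refine le_trans ?_ ((sq_loglog_le_sqrtLogBudget hK).trans hsq)
  calc c * Nat.log 2 (Nat.log 2 n) ≤ c * (Nat.log 2 (Nat.log 2 (Nat.sqrt n)) + 2) :=
        Nat.mul_le_mul_left c hKn
    _ ≤ Nat.log 2 (Nat.log 2 (Nat.sqrt n)) ^ 2 := by nlinarith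

/-- **Crux #3's family almost everywhere, one language for all `c`**: the padded `⌊√m⌋`-clique
language has, for every `c` and `k` and ALL large `n`, a monotone slice of negation-limited
complexity `> n^k` under `c ⌊log₂⌊log₂ n⌋⌋` NOT gates (stmt-PneNP-0412 / R3R with `∀ᶠ` and a
`c`-independent witness). -/
theorem neglimitedAllCLoglogNegations_ae :
    ∃ L ∈ Literature.Computability.Complexity.Nondeterministic.NP, ∀ c k : ℕ,
      ∀ᶠ n : ℕ in Filter.atTop, Monotone (L.sliceFn n) ∧ n ^ k <
        Literature.Computability.Complexity.negLimitedSizeOver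
          Literature.Computability.Complexity.deMorganBasis (c * Nat.log 2 (Nat.log 2 n))
          (L.sliceFn n) := by
  refine ⟨padCliqueLang, padCliqueLang_mem_NP, fun c k => ?_⟩
  -- `⌊√n⌋ → ∞` [folklore], stated locally
  have tendsto_sqrt_atTop : Tendsto Nat.sqrt atTop atTop :=
    tendsto_atTop_atTop.2 fun b => ⟨b * b, fun n hn => by
      rw [← Nat.sqrt_eq b]; exact Nat.sqrt_le_sqrt hn⟩
  filter_upwards [tendsto_sqrt_atTop.eventually (NegLimLog.cliqueLikeNegLimitedLog (4 * k + 1)),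
    tendsto_sqrt_atTop.eventually (eventually_ge_atTop 4),
    tendsto_sqrt_atTop.eventually (tendsto_loglog.eventually_ge_atTop (max 64 (c + 2)))]
    with n hT h4 hK
  have hle : Nat.sqrt n ^ (4 * k + 1) ≤ negLimitedSizeOver deMorganBasis
      (c * Nat.log 2 (Nat.log 2 n)) (padCliqueLang.sliceFn n) :=
    le_negLimitedSizeOver_sliceFn_pad h4 fun D hD hDT hneg =>
      hT _ (cliqueLike_cliqueFn (m := Nat.sqrt n) (Nat.le_sqrt.2 (by omega))) D hD hDT
        (hneg.trans (cloglog_le_logBudget_sqrt (le_trans (le_max_left _ _) hK)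
          (le_trans (le_max_right _ _) hK)))
  exact ⟨monotone_sliceFn_padCliqueLang (by nlinarith [Nat.sqrt_le n]),
    lt_of_lt_of_le (pow_lt_sqrt_pow h4 k) hle⟩

/-- **Headline form (Markov-style): polynomial-size De Morgan circuits for the padded clique language
need `> ⌊log₂ n⌋ / (100 (⌊log₂⌊log₂ n⌋⌋ + 1))` NOT gates at every large length.** For every `k`, for
all large `n`, every De Morgan circuit of size `≤ n^k` computing the slice has more NOT gates than
that. [cite: AmanoMaruoka2005, §1] -/
theorem negations_needed_ae (k : ℕ) :
    ∀ᶠ n : ℕ in Filter.atTop, ∀ C : Circuit (Fin n), C.IsOver deMorganBasis →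
      C.Computes (padCliqueLang.sliceFn n) → C.size ≤ n ^ k →
        Nat.log 2 n / (100 * (Nat.log 2 (Nat.log 2 n) + 1)) < C.negationCount := by
  -- `⌊√n⌋ → ∞` [folklore], stated locally
  have tendsto_sqrt_atTop : Tendsto Nat.sqrt atTop atTop :=
    tendsto_atTop_atTop.2 fun b => ⟨b * b, fun n hn => by
      rw [← Nat.sqrt_eq b]; exact Nat.sqrt_le_sqrt hn⟩
  filter_upwards [tendsto_sqrt_atTop.eventually (NegLimLog.cliqueLikeNegLimitedLog (4 * k + 1)),
    tendsto_sqrt_atTop.eventually (eventually_ge_atTop 4)] with n hT h4 C hC hcomp hsize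
  by_contra h'
  have hneg : C.negationCount ≤ Nat.log 2 n / (100 * (Nat.log 2 (Nat.log 2 n) + 1)) :=
    not_lt.1 h'
  have hle : Nat.sqrt n ^ (4 * k + 1) ≤ negLimitedSizeOver deMorganBasis
      (Nat.log 2 n / (100 * (Nat.log 2 (Nat.log 2 n) + 1))) (padCliqueLang.sliceFn n) :=
    le_negLimitedSizeOver_sliceFn_pad h4 fun D hD hDT hDneg =>
      hT _ (cliqueLike_cliqueFn (m := Nat.sqrt n) (Nat.le_sqrt.2 (by omega))) D hD hDT
        (hDneg.trans (budget100_le_logBudget_sqrt (by omega)))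
  have hCle : negLimitedSizeOver deMorganBasis
      (Nat.log 2 n / (100 * (Nat.log 2 (Nat.log 2 n) + 1))) (padCliqueLang.sliceFn n) ≤ C.size :=
    negLimitedSizeOver_le_of_computes C hC hneg hcomp
  have hlt := pow_lt_sqrt_pow h4 k
  omega

end Summit.PneNP.PneNP.Theorems.NegLimSlices

namespace Summit.PneNP.PneNP.Theorems

/-- **stmt-PneNP-19897 (`NegLimited.NeglimitedLogOverLoglogNegationsAE`, R35 a.e.) PROVED, by name.**
[cite: AmanoMaruoka2005, §1] [cite: AroraBarak2009, §2.1] -/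
theorem neglimitedLogOverLoglogNegationsAE_holds :
    Summit.PneNP.PneNP.Theses.NegLimited.NeglimitedLogOverLoglogNegationsAE :=
  NegLimSlices.neglimitedLogOverLoglogNegations_ae

end Summit.PneNP.PneNP.Theorems
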